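import Literature.NumberTheory.PAdicHodge.FilZeroCoboundaryOfPeriodHoms
import HarnessLib

/-!
# Legendre divisibility in `B_dR(F)`: an element of `Fil¹ ∖ Fil²` divides `Fil¹` into `B_dR⁺`

Topic `Literature/NumberTheory/PAdicHodge`; namespace `Literature.NumberTheory.PAdicHodge`. THEOREMS ONLY (no definition, no
named fact, no instance, no `sorry`). Sequel of `FilZeroCoboundaryOfPeriodHoms` (the `Fil⁰`-coboundary from a
Legendre-transversal pair of integrated periods, with the transversality phrased as a DIVISIBILITY hypothesis
`∀ y ∈ Fil¹, ∃ z ∈ Fil⁰, y = z·Δ`) and of `BdRPlusDVR` / `BdRField` (`B_dR⁺(F)` is a discrete valuation ring with uniformizer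
`ξ`; `Fil^i B_dR = ξ^i B_dR⁺`).

* §1 **`exists_mem_fil_zero_eq_mul_of_not_mem_fil_two`**: in Fontaine's datum `bdRPeriodRingData hp`, an element
  `Δ ∈ Fil¹ ∖ Fil²` is `ξ × (unit of B_dR⁺)`, hence every `y ∈ Fil¹` is `z·Δ` with `z ∈ Fil⁰ = B_dR⁺`. So for `B_dR` the divisibility
  hypothesis of `isFilZeroCoboundary_of_pair_of_legendre` IS the Legendre transversality `Δ ∉ Fil²` of the period determinant.
* §2 **`isFilZeroCoboundary_restrictedRationalTateRep_of_periodHoms_of_not_mem_fil_two`**: the (S5a)-shaped conclusion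
  `(bdRPeriodRingData hp).IsFilZeroCoboundary (restrictedRationalTateRep W F p) (σ ↦ 1 ⊗ toRational (η σ))` from two period maps
  `φ₁ ⊆ Fil¹`, `φ₂ ⊆ B_dR⁺` on `T_pW`, integrated periods `b₁ ∈ Fil¹`, `b₂ ∈ B_dR⁺` of `η`, and `Δ = Φ₁(v₀)Φ₂(v₁) − Φ₁(v₁)Φ₂(v₀) ∉ Fil²`
  on a `ℚ_p`-basis `v` of `V_pW`.
* The BASIS-FREE criterion (Legendre discharged by Tate's theorem) is the sequel `KummerFilZeroCoboundaryCriterion`.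

Use: brick K1 of the hT₂ programme of crux K★ `stmt-BirchSwinnertonDyer-22226` — with the integrating pair of
`AinfWeierstrassKummerIntegral{,Eta}` (`b_ω ∈ Fil¹`) the only input left for «Kummer classes of rational formal points die in
`H¹(F, B_dR⁺ ⊗ V)»` is `Δ ∉ Fil²` for the period matrix of `(∫ω, ∫η)` (Colmez 1992 §2: `Δ = t·(Weil pairing)`; or Tate's
`ℂ_F(1)^{Γ_F} = 0`, tree `TateTwistInvariants`), plus the matching `T_pŴ ≅ T_pW`. BSD / K★ are not proved by any of this.

## References
* [FontaineAsterisque223III] J.-M. Fontaine, Astérisque 223 (1994), Exp. II §1.5.5 (`B_dR⁺` a DVR, `Fil^i = ξ^i B_dR⁺`).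
* [Colmez1992PeriodesAbeliennes] P. Colmez, Math. Ann. 292 (1992), §2 (Legendre's relation).
* [BlochKato1990] S. Bloch, K. Kato (1990), Ex. 3.10.1, (3.11.1), Lemma 3.8.1.
-/

noncomputable section

open scoped TensorProduct

namespace Literature.NumberTheory.PAdicHodge

open Literature Literature.NumberTheory.GaloisRepresentations Literature.NumberTheory.EllipticCurves WeierstrassCurve
open Literature.NumberTheory.GaloisRepresentations.IsNonarchimedeanLocalField Field ValuativeRel WittVector

variable {F : Type} [Field F] [ValuativeRel F] [TopologicalSpace F] [IsNonarchimedeanLocalField F] [CharZero F]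
  {p : ℕ} [Fact p.Prime] [Fact (¬ IsUnit (p : integerC F))] [IsAdicComplete (Ideal.span {(p : integerC F)}) (integerC F)]
  (hp : valuation F p < 1) [Algebra ℚ_[p] F]

/-! ## §1 `Δ ∈ Fil¹ ∖ Fil²` divides `Fil¹` into `Fil⁰` -/

/-- **An element of `Fil¹B_dR ∖ Fil²B_dR` is `ξ · (unit of B_dR⁺)`** (`B_dR⁺` is a DVR with uniformizer `ξ`).
[cite: FontaineAsterisque223III, Exp. II §1.5.5] -/
theorem exists_isUnit_eq_xi_mul_of_not_mem_fil_two {Δ : (bdRPeriodRingData (F := F) (p := p) hp).B}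
    (h1 : Δ ∈ (bdRPeriodRingData (F := F) (p := p) hp).fil 1) (h2 : Δ ∉ (bdRPeriodRingData (F := F) (p := p) hp).fil 2) :
    ∃ w : BDeRhamPlus (integerC F) p, IsUnit w ∧
      Δ = algebraMap (BDeRhamPlus (integerC F) p) (FracBdR F p) xiBdR * algebraMap (BDeRhamPlus (integerC F) p) (FracBdR F p) w := by
  have hF := surjective_fontaineTheta_integerC hp
  haveI : IsDomain (BDeRhamPlus (integerC F) p) := isDomain_bDeRhamPlus hF
  letI : Algebra F (FracBdR F p) := fracAlgebra hp hF
  have mem_fil : ∀ (i : ℤ) (x : (bdRPeriodRingData (F := F) (p := p) hp).B),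
      x ∈ (bdRPeriodRingData (F := F) (p := p) hp).fil i ↔ ∃ b : BDeRhamPlus (integerC F) p,
        x = algebraMap (BDeRhamPlus (integerC F) p) (FracBdR F p) xiBdR ^ i *
          algebraMap (BDeRhamPlus (integerC F) p) (FracBdR F p) b :=
    fun i x => mem_fil_iff hp hF
  obtain ⟨b, hb⟩ := (mem_fil 1 _).1 h1
  rw [zpow_one] at hb
  have hb0 : b ≠ 0 := by
    rintro rfl
    apply h2
    rw [mem_fil]
    exact ⟨0, by rw [hb, map_zero, mul_zero, mul_zero]⟩
  obtain ⟨n, w, hw, rfl⟩ := exists_eq_xi_pow_mul_bDeRhamPlus hF hb0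
  cases n with
  | zero =>
    exact ⟨w, hw, by rw [hb, pow_zero, one_mul]⟩
  | succ n =>
    exfalso
    apply h2
    rw [mem_fil]
    refine ⟨xiBdR ^ n * w, ?_⟩
    rw [hb, map_mul, map_mul, map_pow, map_pow, pow_succ]
    have h2' : (2 : ℤ) = ((2 : ℕ) : ℤ) := rfl
    rw [h2', zpow_natCast]
    ring

/-- **Legendre divisibility in `B_dR(F)`**: if `Δ ∈ Fil¹ ∖ Fil²`, then every `y ∈ Fil¹` is `z·Δ` with `z ∈ Fil⁰ = B_dR⁺` — the
divisibility hypothesis of `PeriodRingData.isFilZeroCoboundary_of_pair_of_legendre` for Fontaine's datum.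
[cite: FontaineAsterisque223III, Exp. II §1.5.5] [cite: Colmez1992PeriodesAbeliennes, §2] -/
theorem exists_mem_fil_zero_eq_mul_of_not_mem_fil_two {Δ : (bdRPeriodRingData (F := F) (p := p) hp).B}
    (h1 : Δ ∈ (bdRPeriodRingData (F := F) (p := p) hp).fil 1) (h2 : Δ ∉ (bdRPeriodRingData (F := F) (p := p) hp).fil 2) :
    ∀ y ∈ (bdRPeriodRingData (F := F) (p := p) hp).fil 1, ∃ z ∈ (bdRPeriodRingData (F := F) (p := p) hp).fil 0, y = z * Δ := by
  have hF := surjective_fontaineTheta_integerC hp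
  haveI : IsDomain (BDeRhamPlus (integerC F) p) := isDomain_bDeRhamPlus hF
  letI : Algebra F (FracBdR F p) := fracAlgebra hp hF
  have mem_fil : ∀ (i : ℤ) (x : (bdRPeriodRingData (F := F) (p := p) hp).B),
      x ∈ (bdRPeriodRingData (F := F) (p := p) hp).fil i ↔ ∃ b : BDeRhamPlus (integerC F) p,
        x = algebraMap (BDeRhamPlus (integerC F) p) (FracBdR F p) xiBdR ^ i *
          algebraMap (BDeRhamPlus (integerC F) p) (FracBdR F p) b :=
    fun i x => mem_fil_iff hp hF
  obtain ⟨w, hw, hΔ⟩ := exists_isUnit_eq_xi_mul_of_not_mem_fil_two hp h1 h2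
  intro y hy
  obtain ⟨c, rfl⟩ := (mem_fil 1 _).1 hy
  refine ⟨algebraMap (BDeRhamPlus (integerC F) p) (FracBdR F p) (c * ((hw.unit⁻¹ : (BDeRhamPlus (integerC F) p)ˣ) : BDeRhamPlus (integerC F) p)),
    ?_, ?_⟩
  · exact (mem_fil 0 _).2 ⟨_, by rw [zpow_zero, one_mul]⟩
  · rw [hΔ, zpow_one, map_mul, algebraMap_units_inv, IsUnit.unit_spec]
    have hw0 : algebraMap (BDeRhamPlus (integerC F) p) (FracBdR F p) w ≠ 0 :=
      (map_ne_zero_iff _ algebraMap_fracBdR_injective).2 hw.ne_zero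
    have key : algebraMap (BDeRhamPlus (integerC F) p) (FracBdR F p) c *
        (algebraMap (BDeRhamPlus (integerC F) p) (FracBdR F p) w)⁻¹ *
        (algebraMap (BDeRhamPlus (integerC F) p) (FracBdR F p) xiBdR * algebraMap (BDeRhamPlus (integerC F) p) (FracBdR F p) w) =
        algebraMap (BDeRhamPlus (integerC F) p) (FracBdR F p) xiBdR * algebraMap (BDeRhamPlus (integerC F) p) (FracBdR F p) c := by
      field_simp
    exact key.symm

/-! ## §2 The (S5a)-shaped conclusion from `Δ ∉ Fil²` -/

/-- **Kummer-type classes die in `H¹(F, B_dR⁺ ⊗ V_pW)`, from two integrated periods with `Δ ∉ Fil²`.** `W` over a subfield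
`K₀ ⊆ F`; `φ₁ φ₂ : T_pW →+ B_dR(F)` additive, `ℤ_p`-homogeneous, `Γ_F`-equivariant, `φ₁ ⊆ Fil¹` (some value `≠ 0`), `φ₂ ⊆ B_dR⁺`
(some value `∉ Fil¹`); on a `ℚ_p`-basis `v` of `V_pW` the determinant `Δ = Φ₁(v₀)Φ₂(v₁) − Φ₁(v₁)Φ₂(v₀)` of (any) `ℚ_p`-linear
extensions `Φᵢ` of `φᵢ` is NOT in `Fil²`; `η : Γ_F → T_pW` with `φ₁(η σ) = σ b₁ − b₁`, `b₁ ∈ Fil¹`, `φ₂(η σ) = σ b₂ − b₂`, `b₂ ∈ B_dR⁺`.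
Then `(bdRPeriodRingData hp).IsFilZeroCoboundary (restrictedRationalTateRep W F p) (σ ↦ 1 ⊗ toRational (η σ))`.
[cite: BlochKato1990, Ex. 3.10.1, (3.11.1), Lemma 3.8.1] [cite: Colmez1992PeriodesAbeliennes, §2] -/
theorem isFilZeroCoboundary_restrictedRationalTateRep_of_periodHoms_of_not_mem_fil_two {K₀ : Type} [Field K₀] [CharZero K₀]
    (W : WeierstrassCurve K₀) [W.IsElliptic] [Algebra K₀ F]
    (v : Module.Basis (Fin 2) ℚ_[p] (W.rationalTateModule p))
    (φ₁ φ₂ : W.tateModule p →+ (bdRPeriodRingData (F := F) (p := p) hp).B)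
    (hφ₁ : ∀ (c : ℤ_[p]) (a : W.tateModule p), φ₁ (c • a) = (c : ℚ_[p]) • φ₁ a)
    (hφ₂ : ∀ (c : ℤ_[p]) (a : W.tateModule p), φ₂ (c • a) = (c : ℚ_[p]) • φ₂ a)
    (hσ₁ : ∀ (σ : absoluteGaloisGroup F) (a : W.tateModule p), φ₁ (absGaloisRestrict K₀ F σ • a) = σ • φ₁ a)
    (hσ₂ : ∀ (σ : absoluteGaloisGroup F) (a : W.tateModule p), φ₂ (absGaloisRestrict K₀ F σ • a) = σ • φ₂ a)
    (hfil₁ : ∀ a, φ₁ a ∈ (bdRPeriodRingData (F := F) (p := p) hp).fil 1)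
    (hfil₂ : ∀ a, φ₂ a ∈ (bdRPeriodRingData (F := F) (p := p) hp).fil 0) (hne : ∃ a, φ₁ a ≠ 0)
    (hnot : ∃ a, φ₂ a ∉ (bdRPeriodRingData (F := F) (p := p) hp).fil 1)
    (hdet : ∀ (Φ₁ Φ₂ : W.rationalTateModule p →ₗ[ℚ_[p]] (bdRPeriodRingData (F := F) (p := p) hp).B),
      (∀ a, Φ₁ (TateModule.toRational p a) = φ₁ a) → (∀ a, Φ₂ (TateModule.toRational p a) = φ₂ a) →
      Φ₁ (v 0) * Φ₂ (v 1) - Φ₁ (v 1) * Φ₂ (v 0) ∉ (bdRPeriodRingData (F := F) (p := p) hp).fil 2)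
    (η : absoluteGaloisGroup F → W.tateModule p) {b₁ b₂ : (bdRPeriodRingData (F := F) (p := p) hp).B}
    (hb₁ : b₁ ∈ (bdRPeriodRingData (F := F) (p := p) hp).fil 1) (hb₂ : b₂ ∈ (bdRPeriodRingData (F := F) (p := p) hp).fil 0)
    (hη₁ : ∀ σ, φ₁ (η σ) = σ • b₁ - b₁) (hη₂ : ∀ σ, φ₂ (η σ) = σ • b₂ - b₂) :
    (bdRPeriodRingData (F := F) (p := p) hp).IsFilZeroCoboundary (restrictedRationalTateRep W F p) fun σ =>
      ((1 : (bdRPeriodRingData (F := F) (p := p) hp).B) ⊗ₜ[ℚ_[p]] TateModule.toRational p (η σ) :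
        (bdRPeriodRingData (F := F) (p := p) hp).B ⊗[ℚ_[p]] W.rationalTateModule p) := by
  refine isFilZeroCoboundary_restrictedRationalTateRep_of_periodHoms_of_legendre hp W v φ₁ φ₂ hφ₁ hφ₂ hσ₁ hσ₂ hfil₁ hfil₂ hne
    hnot (fun Φ₁ Φ₂ hΦ₁ hΦ₂ => ?_) η hb₁ hb₂ hη₁ hη₂
  -- `Δ ∈ Fil¹` (its `Φ₁`-factors are in `Fil¹`, its `Φ₂`-factors in `Fil⁰`) and `Δ ∉ Fil²`
  have hΦ₁fil : ∀ x, Φ₁ x ∈ (bdRPeriodRingData (F := F) (p := p) hp).fil 1 :=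
    apply_mem_of_forall_toRational_mem _ Φ₁ _ fun a => by rw [hΦ₁]; exact hfil₁ a
  have hΦ₂fil : ∀ x, Φ₂ x ∈ (bdRPeriodRingData (F := F) (p := p) hp).fil 0 :=
    apply_mem_of_forall_toRational_mem _ Φ₂ _ fun a => by rw [hΦ₂]; exact hfil₂ a
  have hΔ1 : Φ₁ (v 0) * Φ₂ (v 1) - Φ₁ (v 1) * Φ₂ (v 0) ∈ (bdRPeriodRingData (F := F) (p := p) hp).fil 1 := by
    refine sub_mem ?_ ?_
    · simpa using (bdRPeriodRingData (F := F) (p := p) hp).mul_mem_fil 1 0 _ _ (hΦ₁fil (v 0)) (hΦ₂fil (v 1))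
    · simpa using (bdRPeriodRingData (F := F) (p := p) hp).mul_mem_fil 1 0 _ _ (hΦ₁fil (v 1)) (hΦ₂fil (v 0))
  exact exists_mem_fil_zero_eq_mul_of_not_mem_fil_two hp hΔ1 (hdet Φ₁ Φ₂ hΦ₁ hΦ₂)

end Literature.NumberTheory.PAdicHodge

end
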